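import Literature.AlgebraicGeometry.Frobenioids.FactorizationTransportWeak
import Literature.AlgebraicGeometry.Frobenioids.PerfFactorialPrimes
import Literature.AlgebraicGeometry.Frobenioids.DirectSumMonoids
import Literature.AlgebraicGeometry.Frobenioids.ElementaryFrobeniusCompact
import Literature.AlgebraicGeometry.Frobenioids.MonoidTransport
import Literature.AlgebraicGeometry.Frobenioids.PerfectionDivisorial
import Literature.AlgebraicGeometry.Frobenioids.PiNatMonoid
import Literature.AnabelianGeometry.EtaleTheta.Conventions
import HarnessLib

/-!
# [FrdI] Def. 2.4 (i), weak form: GROUP-SATURATED, PERF-DENSE submonoids of a weakly perf-factorial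
# monoid with `ℤ`-monoprime components are weakly perf-factorial (with `ℤ`-monoprime components), and
# cofinality (d_cof) descends — the abstract content of [EtTh] Prop. 3.2 (i) ⟹ Prop. 3.4 (i)

Mochizuki, *The geometry of Frobenioids I*, Kyushu J. Math. **62** (2008), §0 pp. 11–12 (perfection,
primes, `M_𝔭`, monoprime) and Def. 2.4 (i) p. 47 (perf-factorial) [cite: MochizukiFrdI2008, Def. 2.4(i) p.47];
Mochizuki, *The étale theta function …*, Publ. RIMS **45** (2009), Prop. 3.2 (i) PDF p. 70 ("there exists a
positive integer `n` such that `n · DIV⁺(Z^log_∞) ⊆ Div⁺(Z^log_∞)`") and Prop. 3.4 (i) PDF p. 74 ("each of the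
monoids `Div⁺(Z^log_∞)^{Gal(Z^log_∞/Y^log)}` … is perf-factorial … The fact that `M` is perf-factorial then
follows immediately from Proposition 3.2, (i)") [cite: MochizukiEtTh2009, Prop 3.4 p.74].

abc-iut cell, W6 cone prover abc-iut-w6-d057 (W6-TRANCHE-2 row EtTh:Prop3.4(i)); F-L2d2-1 / F-L2d2-2 repair
chain (the printed [FrdI] Def. 2.4 (i)(d) FAILS for `∏_ℕ ℤ≥0`, `PerfFactorialProductCounterexample`; the cell's
reading of record is the WEAK notion `IsPerfFactorialWeak` + cofinality (d_cof), `FactorizationTransportWeak`).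
PROOF-ONLY (theorems only; no definitions).  THE ENGINE: let `P` be a commutative monoid and
`M ⊆ P` a submonoid which is

* GROUP-SATURATED ([EtTh] §0 p. 8, the tree's `IsGroupSaturated M`): `q · b = a` with `a, b ∈ M` forces `q ∈ M`, and
* PERF-DENSE ([EtTh] §0 p. 8: the perf-saturation `perfSaturation M` is all of `P`): every `x ∈ P` has some power
  `x^n ∈ M`, `n ≥ 1`

— exactly the relation of `Div⁺(Z^log_∞) = Div ∩ DIV⁺` to `DIV⁺(Z^log_∞) ≅ ∏ ℤ≥0` given by [EtTh] Prop. 3.2 (i).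
Then: divisibility and `≼` in `M` are those of `P` (`coe_dvd_iff`, `coe_precsim_iff`); primary elements of `M`
are the primary elements of `P` lying in `M` (`isPrimary_coe_iff`); `M` is divisorial if `P` is
(`isDivisorial`); every `M_𝔭` embeds in the corresponding `P_𝔮`, divisibility-reflectingly, so if the `P_𝔮` are
`ℤ`-monoprime then so are the `M_𝔭` (`exists_submonoid_embedding`, `isZMonoprime_submonoid_primes` — a nontrivial
submonoid of `ℤ≥0` closed under differences is `d·ℤ≥0 ≅ ℤ≥0`, `nonempty_mulEquiv_multiplicativeNat_of_dvd_reflecting`);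
`M^pf ≅ P^pf` (`nonempty_perfectionEquiv`), so (c) + (d_ord) + (d_res) and (d_cof) TRANSPORT (`Factorization.CondWeak.of_mulEquiv`,
`Factorization.Cofinal.of_mulEquiv`).  Main results: **`isPerfFactorialWeak`**, **`rlfCofinal`**,
**`isZMonoprime_submonoid_primes`** (namespace `GroupSaturatedSubmonoid`), and `PiNat.isZMonoprime_submonoid_prime`
(the `ℤ`-monoprime form of `PiNat.isMonoprime_submonoid_prime`).  The `ℤ`-monoprime hypothesis is NEEDED:
`ℤ[1/2]_{≥0} ⊆ ℚ_{≥0}` is group-saturated and perf-dense but not monoprime.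
HONEST FRAMING: classical monoid algebra; nothing here bears on [IUTchIII] Cor. 3.12.
-/

noncomputable section

namespace Literature.AlgebraicGeometry.Frobenioids

open Function

universe u

/-! ### A nontrivial submonoid of `ℤ≥0` closed under differences is `≅ ℤ≥0` -/

section NatSubmonoid

variable {S : Type u} [CommMonoid S]

/-- Divisibility in `Multiplicative ℕ` is the order of `ℕ`. [folklore] -/
private theorem multiplicativeNat_dvd_iff {a b : Multiplicative ℕ} : a ∣ b ↔ Multiplicative.toAdd a ≤ Multiplicative.toAdd b := by
  constructor
  · rintro ⟨c, rfl⟩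
    rw [toAdd_mul]
    exact Nat.le_add_right _ _
  · intro h
    refine ⟨Multiplicative.ofAdd (Multiplicative.toAdd b - Multiplicative.toAdd a), ?_⟩
    apply Multiplicative.toAdd.injective
    rw [toAdd_mul, toAdd_ofAdd, Nat.add_sub_cancel' h]

/-- **A monoid embedded in `ℤ≥0` by a divisibility-reflecting homomorphism, and nontrivial, is `≅ ℤ≥0`**: its
image is a nonzero subset of `ℕ` closed under `+` and under differences, hence `d·ℕ` for its least positive
element `d` (Euclid). (The structure of the `M_𝔭 ⊆ ℤ≥0` of a saturated submonoid of a free monoid, cf. [FrdI]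
Ex. 6.1 p. 109 "`Φ(L)_𝔭 ≅ ℤ≥0`".) [cite: MochizukiFrdI2008, §0 p.10] -/
theorem nonempty_mulEquiv_multiplicativeNat_of_dvd_reflecting (ν : S →* Multiplicative ℕ) (hν : Injective ν)
    (hrefl : ∀ x y : S, ν y ∣ ν x → y ∣ x) (hS : ∃ x : S, x ≠ 1) : Nonempty (S ≃* Multiplicative ℕ) := by
  classical
  -- exponents
  let e : S → ℕ := fun x => Multiplicative.toAdd (ν x)
  have he_mul : ∀ x y, e (x * y) = e x + e y := fun x y => by
    simp only [e, map_mul, toAdd_mul]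
  have he_inj : ∀ x y, e x = e y → x = y := fun x y h => hν (Multiplicative.toAdd.injective h)
  have he_one : ∀ x, e x = 0 ↔ x = 1 := fun x => by
    constructor
    · intro h
      exact he_inj x 1 (by rw [h]; simp [e])
    · rintro rfl; simp [e]
  -- differences: `e y ≤ e x` gives `x = y * w`
  have hsub : ∀ x y, e y ≤ e x → ∃ w, x = y * w := fun x y h =>
    hrefl x y (multiplicativeNat_dvd_iff.mpr h)
  -- the least positive exponent
  have hex : ∃ n, 0 < n ∧ ∃ x, e x = n := by
    obtain ⟨x, hx⟩ := hS
    exact ⟨e x, Nat.pos_of_ne_zero fun h => hx ((he_one x).mp h), x, rfl⟩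
  obtain ⟨hd0, x₀, hx₀⟩ := Nat.find_spec hex
  set d := Nat.find hex with hd
  have hmin : ∀ x, e x < d → e x = 0 := fun x hlt => by
    by_contra h0
    exact Nat.find_min hex hlt ⟨Nat.pos_of_ne_zero h0, x, rfl⟩
  -- every exponent is a multiple of `d`
  have hdvd : ∀ x, d ∣ e x := by
    intro x
    -- subtract `d` as long as possible: `e x - q * d` is an exponent for `q * d ≤ e x`
    have key : ∀ q, q * d ≤ e x → ∃ w, e w = e x - q * d := by
      intro q
      induction q with
      | zero => intro _; exact ⟨x, by simp⟩
      | succ q ih =>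
        intro hq
        have hq1 : q * d + d ≤ e x := by simpa [Nat.succ_mul] using hq
        have hq' : q * d ≤ e x := le_trans (Nat.le_add_right _ _) hq1
        obtain ⟨w, hw⟩ := ih hq'
        have hdw : e x₀ ≤ e w := by rw [hx₀, hw]; omega
        obtain ⟨w', hw'⟩ := hsub w x₀ hdw
        refine ⟨w', ?_⟩
        have hsum : e w = e x₀ + e w' := by rw [← he_mul, ← hw']
        rw [hx₀, hw] at hsum
        rw [Nat.succ_mul]
        omega
    obtain ⟨w, hw⟩ := key (e x / d) (Nat.div_mul_le_self (e x) d)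
    have hdm : e x / d * d + e x % d = e x := Nat.div_add_mod' (e x) d
    have h2 : e x % d < d := Nat.mod_lt (e x) hd0
    have hlt : e w < d := by rw [hw]; omega
    have h0 := hmin w hlt
    rw [hw] at h0
    exact ⟨e x / d, by rw [Nat.mul_comm]; omega⟩
  -- the equivalence `x ↦ e x / d`, inverse `k ↦ x₀ ^ k`
  have he_pow : ∀ k : ℕ, e (x₀ ^ k) = k * d := fun k => by
    induction k with
    | zero => simp [e]
    | succ k ih => rw [pow_succ, he_mul, ih, hx₀, Nat.succ_mul]
  refine ⟨{ toFun := fun x => Multiplicative.ofAdd (e x / d),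
            invFun := fun k => x₀ ^ Multiplicative.toAdd k,
            left_inv := fun x => ?_,
            right_inv := fun k => ?_,
            map_mul' := fun x y => ?_ }⟩
  · apply he_inj
    rw [he_pow, toAdd_ofAdd, Nat.div_mul_cancel (hdvd x)]
  · apply Multiplicative.toAdd.injective
    rw [toAdd_ofAdd, he_pow, Nat.mul_div_cancel _ hd0]
  · apply Multiplicative.toAdd.injective
    rw [toAdd_mul, toAdd_ofAdd, toAdd_ofAdd, toAdd_ofAdd, he_mul,
      Nat.add_div_of_dvd_right (hdvd x)]

end NatSubmonoid

/-! ### `∏_J ℤ≥0`: the prime components are `ℤ`-monoprime (the `ℤ`-form of `PiNat.isMonoprime_submonoid_prime`) -/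

namespace PiNat

variable {J : Type u}

/-- **Every prime component `(∏_J ℤ≥0)_𝔭 ≅ ℤ≥0` is `ℤ`-monoprime** (same isomorphism as in
`PiNat.isMonoprime_submonoid_prime`, recorded with its monoid type). [cite: MochizukiFrdI2008, Def. 2.4(i) p.47] -/
theorem isZMonoprime_submonoid_prime (𝔭 : Primes (Multiplicative (J → ℕ))) : IsZMonoprime ↥𝔭.submonoid := by
  classical
  obtain ⟨j, rfl⟩ := prime_bijective.2 𝔭
  refine ⟨⟨MulEquiv.symm ?_⟩⟩
  refine { toFun := fun k => ⟨single j (Multiplicative.toAdd k), mem_submonoid_prime_iff.2 ⟨_, rfl⟩⟩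
           invFun := fun f => Multiplicative.ofAdd (coeff f.1 j)
           left_inv := fun k => by simp
           right_inv := fun f => ?_
           map_mul' := fun k l => Subtype.ext (by simp [single_mul_single]) }
  obtain ⟨k, hk⟩ := mem_submonoid_prime_iff.1 f.2
  apply Subtype.ext
  simp [hk]

end PiNat

/-! ### Group-saturated, perf-dense submonoids -/

namespace GroupSaturatedSubmonoid

open Literature.AnabelianGeometry.EtaleTheta

variable {P : Type u} [CommMonoid P] {M : Submonoid P}

/-- Divisibility in a group-saturated submonoid is divisibility in the ambient monoid.
[cite: MochizukiEtTh2009, §0 p.8] -/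
theorem coe_dvd_iff (hsat : IsGroupSaturated M) {a b : M} : (a : P) ∣ (b : P) ↔ a ∣ b := by
  constructor
  · rintro ⟨q, hq⟩
    have hqM : q ∈ M :=
      (isGroupSaturated_iff' M).mp hsat q b b.2 a a.2 (by rw [mul_comm]; exact hq.symm)
    exact ⟨⟨q, hqM⟩, Subtype.ext hq⟩
  · rintro ⟨c, rfl⟩
    exact ⟨c, rfl⟩

/-- `≼` in a group-saturated submonoid is `≼` in the ambient monoid. [cite: MochizukiFrdI2008, §0 p.12] -/
theorem coe_precsim_iff (hsat : IsGroupSaturated M) {a b : M} : Precsim (a : P) (b : P) ↔ Precsim a b := by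
  constructor
  · rintro ⟨n, hn, h⟩
    exact ⟨n, hn, (coe_dvd_iff hsat).mp (by rwa [SubmonoidClass.coe_pow])⟩
  · rintro ⟨n, hn, h⟩
    exact ⟨n, hn, by rw [← SubmonoidClass.coe_pow]; exact (coe_dvd_iff hsat).mpr h⟩

/-- A submonoid of a sharp monoid is sharp. [cite: MochizukiFrdI2008, §0 p.11] -/
theorem isSharp (hP : IsSharp P) : IsSharp M :=
  ⟨fun a ha => Subtype.ext (hP.1 (a : P) (ha.map M.subtype))⟩

/-- `a ≠ 1` in `M` iff `(a : P) ≠ 1`. [folklore] -/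
private theorem coe_ne_one_iff {a : M} : (a : P) ≠ 1 ↔ a ≠ 1 := not_congr OneMemClass.coe_eq_one

/-- **Primary elements of a group-saturated, perf-dense submonoid `M` of a sharp `P` are exactly the primary
elements of `P` lying in `M`.** [cite: MochizukiFrdI2008, §0 p.12] -/
theorem isPrimary_coe_iff (hP : IsSharp P) (hsat : IsGroupSaturated M) (hdense : ∀ x : P, x ∈ perfSaturation M)
    {a : M} : IsPrimary (a : P) ↔ IsPrimary a := by
  constructor
  · rintro ⟨ha1, ha⟩
    refine ⟨coe_ne_one_iff.mp ha1, fun b hb hba => ?_⟩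
    exact (coe_precsim_iff hsat).mp (ha b (coe_ne_one_iff.mpr hb) ((coe_precsim_iff hsat).mpr hba))
  · rintro ⟨ha1, ha⟩
    refine ⟨coe_ne_one_iff.mpr ha1, fun c hc hca => ?_⟩
    obtain ⟨n, hn⟩ := (mem_perfSaturation_iff M c).mp (hdense c)
    have hc' : (⟨c ^ (n : ℕ), hn⟩ : M) ≠ 1 := fun h =>
      hc (hP.isTorsionFree.1 c n n.pos (by simpa using congrArg Subtype.val h))
    have hc'a : Precsim (⟨c ^ (n : ℕ), hn⟩ : M) a :=
      (coe_precsim_iff hsat).mp ((pow_precsim_self c n.pos).trans hca)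
    exact ((coe_precsim_iff hsat).mpr (ha _ hc' hc'a)).trans (pow_precsim_self c n.pos)

/-- **`M` is divisorial** (integral, saturated, of characteristic type, sharp) when `P` is divisorial and `M` is
group-saturated: `a^n = c·b^n` in `M` gives `b ∣ a` in `P` (saturation of `P`), hence in `M`.
[cite: MochizukiFrdI2008, Def. 1.1(i) p.19] -/
theorem isDivisorial (hP : IsDivisorial P) (hsat : IsGroupSaturated M) : IsDivisorial M := by
  haveI : IsCancelMul P := isIntegral_iff_isCancelMul.mp hP.isPreDivisorial.isIntegral
  haveI : IsCancelMul M :=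
    { mul_left_cancel := fun a b c h => Subtype.ext (mul_left_cancel (congrArg Subtype.val h))
      mul_right_cancel := fun a b c h => Subtype.ext (mul_right_cancel (congrArg Subtype.val h)) }
  refine isDivisorial_of_dvd_of_pow (isSharp hP.isSharp) fun a b c n hn h => ?_
  have hP' : (b : P) ^ n ∣ (a : P) ^ n := ⟨c, by
    have := congrArg Subtype.val h
    simpa [mul_comm] using this⟩
  exact (coe_dvd_iff hsat).mp (hP.isPreDivisorial.isSaturated.dvd_of_pow_dvd_pow hn hP')

/-- **The prime components embed: `M_𝔭 ↪ P_𝔮`**, injectively and REFLECTING divisibility (a quotient in `P_𝔮` of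
two elements of `M_𝔭` lies in `M` by group saturation and divides an element of `M_𝔭`, so lies in the
divisor-closed `M_𝔭`, §0), for the prime `𝔮` of `P` through any representative of `𝔭`.
[cite: MochizukiFrdI2008, §0 p.12] -/
theorem exists_submonoid_embedding (hP : IsSharp P) (hsat : IsGroupSaturated M)
    (hdense : ∀ x : P, x ∈ perfSaturation M) (𝔭 : Primes M) :
    ∃ (𝔮 : Primes P) (φ : ↥𝔭.submonoid →* ↥𝔮.submonoid),
      Injective φ ∧ (∀ x y, φ y ∣ φ x → y ∣ x) ∧ ∀ x, ((φ x : ↥𝔮.submonoid) : P) = ((x : ↥𝔭.submonoid) : M) := by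
  obtain ⟨⟨p, hp'⟩, hp⟩ := Quotient.exists_rep 𝔭
  have hpc : p ∈ 𝔭.carrier := ⟨hp', hp⟩
  have hpP : IsPrimary (p : P) := (isPrimary_coe_iff hP hsat hdense).mpr hp'
  let 𝔮 : Primes P := Quotient.mk (primarySetoid P) ⟨(p : P), hpP⟩
  have hpc' : (p : P) ∈ 𝔮.carrier := ⟨hpP, rfl⟩
  -- elements of `M_𝔭` map into `P_𝔮`
  have hmem : ∀ x : M, x ∈ 𝔭.submonoid → (x : P) ∈ 𝔮.submonoid := by
    intro x hx
    rcases (𝔭.mem_submonoid_iff hpc x).mp hx with rfl | hxc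
    · rw [OneMemClass.coe_one]; exact Submonoid.one_mem _
    · have hxp : Precsim x p := 𝔭.precsim_of_mem_carrier hxc hpc
      exact Submonoid.subset_closure (𝔮.mem_carrier_of_precsim hpc' (coe_ne_one_iff.mpr hxc.1.1)
        ((coe_precsim_iff hsat).mpr hxp))
  let φ : ↥𝔭.submonoid →* ↥𝔮.submonoid :=
    { toFun := fun x => ⟨(x.1 : P), hmem x.1 x.2⟩
      map_one' := Subtype.ext rfl
      map_mul' := fun _ _ => Subtype.ext rfl }
  refine ⟨𝔮, φ, fun x y h => Subtype.ext (Subtype.ext (congrArg (fun z => (z.1 : P)) h)), fun x y h => ?_,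
    fun _ => rfl⟩
  obtain ⟨w, hw⟩ := h
  have hw' : (x.1 : P) = (y.1 : P) * (w.1 : P) := congrArg (fun z => (z.1 : P)) hw
  have hwM : (w.1 : P) ∈ M :=
    (isGroupSaturated_iff' M).mp hsat _ _ x.1.2 _ y.1.2 (by rw [mul_comm]; exact hw'.symm)
  have hdvd : (⟨(w.1 : P), hwM⟩ : M) ∣ x.1 := ⟨y.1, Subtype.ext (by rw [hw', mul_comm]; rfl)⟩
  have hw𝔭 : (⟨(w.1 : P), hwM⟩ : M) ∈ 𝔭.submonoid := 𝔭.mem_submonoid_of_dvd hdvd x.2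
  exact ⟨⟨_, hw𝔭⟩, Subtype.ext (Subtype.ext (by rw [hw']; rfl))⟩

/-- **Every `M_𝔭` is `ℤ`-monoprime** when the `P_𝔮` are: `M_𝔭 ↪ P_𝔮 ≅ ℤ≥0` is injective, divisibility-reflecting
and nontrivial, hence `M_𝔭 = d·ℤ≥0 ≅ ℤ≥0`. [cite: MochizukiFrdI2008, Def. 2.4(i) p.47] -/
theorem isZMonoprime_submonoid_primes (hP : IsSharp P) (hZ : ∀ 𝔮 : Primes P, IsZMonoprime ↥𝔮.submonoid)
    (hsat : IsGroupSaturated M) (hdense : ∀ x : P, x ∈ perfSaturation M) (𝔭 : Primes M) :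
    IsZMonoprime ↥𝔭.submonoid := by
  obtain ⟨𝔮, φ, hφ, hrefl, -⟩ := exists_submonoid_embedding hP hsat hdense 𝔭
  obtain ⟨⟨e𝔮⟩⟩ := hZ 𝔮
  refine ⟨nonempty_mulEquiv_multiplicativeNat_of_dvd_reflecting (e𝔮.toMonoidHom.comp φ)
    (e𝔮.injective.comp hφ) (fun x y h => hrefl x y ((map_dvd_iff e𝔮).mp h)) ?_⟩
  obtain ⟨⟨p, hp'⟩, hp⟩ := Quotient.exists_rep 𝔭
  exact ⟨⟨p, Submonoid.subset_closure ⟨hp', hp⟩⟩, fun h => hp'.1 (congrArg Subtype.val h)⟩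

/-- **`M^pf ≅ P^pf`** for a perf-dense submonoid: `Perfection.map` of the inclusion is injective (the
inclusion is) and surjective (`x^{1/k} = (x^n)^{1/(kn)}` with `x^n ∈ M`) — the content of [EtTh] Prop. 3.2
(i)'s "natural isomorphism `Div⁺(Z^log_∞)^pf ⥲ DIV⁺(Z^log_∞)^pf`". [cite: MochizukiEtTh2009, Prop 3.2 p.70] -/
theorem nonempty_perfectionEquiv (hdense : ∀ x : P, x ∈ perfSaturation M) :
    Nonempty (Perfection M ≃* Perfection P) :=
  ⟨MulEquiv.ofBijective (Perfection.map M.subtype)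
    ⟨Perfection.map_injective _ Subtype.val_injective, fun y => by
      obtain ⟨⟨x, k⟩, rfl⟩ := Perfection.mk_surjective y
      obtain ⟨n, hn⟩ := (mem_perfSaturation_iff M x).mp (hdense x)
      exact ⟨Perfection.mk ⟨x ^ (n : ℕ), hn⟩ (k * n), by
        rw [Perfection.map_mk]; exact Perfection.mk_pow_mul x k n⟩⟩⟩

/-! ### Main results -/

/-- **A group-saturated, perf-dense submonoid of a weakly perf-factorial monoid with `ℤ`-monoprime components
is weakly perf-factorial** ((a) `isDivisorial`; (b) `isZMonoprime_submonoid_primes`; (c) + (d_ord) + (d_res)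
transported along `M^pf ≅ P^pf`).  With [EtTh] Prop. 3.2 (i) this is [EtTh] Prop. 3.4 (i) for
`Div⁺(Z^log_∞)` in the cell's repaired reading. [cite: MochizukiEtTh2009, Prop 3.4 p.74] -/
theorem isPerfFactorialWeak (hPw : IsPerfFactorialWeak P) (hZ : ∀ 𝔮 : Primes P, IsZMonoprime ↥𝔮.submonoid)
    (hsat : IsGroupSaturated M) (hdense : ∀ x : P, x ∈ perfSaturation M) : IsPerfFactorialWeak M := by
  obtain ⟨e⟩ := nonempty_perfectionEquiv hdense
  exact IsPerfFactorialWeak.of_condWeak (isDivisorial hPw.isDivisorial hsat)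
    (fun 𝔭 => IsMonoprime.ofZ (isZMonoprime_submonoid_primes hPw.isDivisorial.isSharp hZ hsat hdense 𝔭))
    (Factorization.CondWeak.of_mulEquiv e.symm hPw.condWeak)

/-- **(d_cof) descends**: if `P^pf` is cofinal in `P^rlf`, then `M^pf` is cofinal in `M^rlf` (transport along
`M^pf ≅ P^pf`). [cite: MochizukiEtTh2009, Lem 3.5 p.75] -/
theorem rlfCofinal (hPw : IsPerfFactorialWeak P)
    (hcof : ∀ x : hPw.Rlf, ∃ b : Perfection P, x ∣ hPw.toRealification b)
    (hdense : ∀ x : P, x ∈ perfSaturation M) (hM : IsPerfFactorialWeak M) :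
    ∀ x : hM.Rlf, ∃ b : Perfection M, x ∣ hM.toRealification b := by
  obtain ⟨e⟩ := nonempty_perfectionEquiv hdense
  exact hM.rlfCofinal_iff.mpr (Factorization.Cofinal.of_mulEquiv e.symm (hPw.rlfCofinal_iff.mp hcof))

end GroupSaturatedSubmonoid

end Literature.AlgebraicGeometry.Frobenioids

end
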